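import Summits.Parity.GeneralizedHardyLittlewood.Theorems.LeeYangFibresRelativeDimOneMoebiusSplitComposeAux1
import Summits.Parity.GeneralizedHardyLittlewood.Theorems.LeeYangFibresRelativeDimOneMoebiusSplitComposeAux2
import Summits.Parity.GeneralizedHardyLittlewood.Theorems.LeeYangFibresRelativeDimOneMoebiusSplitComposeAux3
import HarnessLib

/-!
# Route `LeeYangFibres`, crux `RelativeDimOne` (stmt-Parity-14113), line `single-moebius-split`:
# the stub `stub_tssCompose` (T1b-C — the truncated singular series of a `d = 1` system)

`stub_tssCompose : (∀ t, TSSInduction t) → (∀ t, TSSLocalData t) → ∀ k, TruncSingularSeriesAsymp (k+1)`: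
uniformly over non-degenerate systems `Ψ` of `t = k + 1` affine-linear forms in one variable with
`‖Ψ‖_N ≤ L`, the truncated singular series `𝔖_R(Ψ)` at staggered levels `R_i = N^{δ_i}` is
`𝔖(Ψ) + o(𝔖(Ψ) + 1)`.  Composition of the two hypotheses:

1. DATA (aux 2, `tssC_data`). Windows `W_p = {0,…,p−1}`, root sets `Z_{p,i} = {r mod p : p ∣ ψ_i(r)}`;
   frozen primes `P = {p ≤ 2t + L}` (a constant set), rough primes `Q =` the prime factors of
   `Π = ∏ |a_i| ∏ |a_i b_{i'} − a_{i'} b_i| ≤ N^{2t²}`: off `P` every `Z_{p,i}` has at most one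
   element and `p > 2t`, off `P ∪ Q` the `Z_{p,i}` are distinct singletons, `|Q| log 2 ≤ 2t² log N`
   and `∏_{p∈Q}(p/(p−1))^t ≤ (2e⁵(2t²+10) log N)^t` (Landau).
2. LEVELS (aux 3, `tssC_levels`). `Rmin = N^{δ_k} ≥ 8`, `Rmin ≤ R_i ≤ Rmax = N`,
   `(∏ P)³ (∏_{j>i} R_j)³ ≤ R_i²` and `C κ^{|P|} A^t (log N)^{m+t} e^{−c√(log Rmin)} ≤ ε` for
   `N ≥ N₀(k, L, δ, ε)` — every constant is fixed BEFORE `N` and `Ψ` are introduced (`B = 2t²/(δ_k log 2)`).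
3. INDUCTION (`TSSInduction t`, hypothesis) bounds `|GY_t(R, g_{W,Z}; x+1) − ∏_{p ≤ x} β_p(W,Z)|` by
   the quantity in 2, hence by `ε`, for every cut-off `x ≥ N + 2t + L`.
4. IDENTIFICATION (aux 1, `tssC_identify`, using `TSSLocalData t`): that difference is
   `𝔖_R(Ψ) − singularProductPartial Ψ x`.
5. LIMIT `x → ∞` (`tendsto_singularProductPartial_holds`, Green–Tao Lemma 1.3):
   `|𝔖_R(Ψ) − 𝔖(Ψ)| ≤ ε ≤ ε (𝔖(Ψ) + 1)` as `𝔖(Ψ) ≥ 0`.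

References: D. A. Goldston, C. Y. Yıldırım, Integers 3 (2003) A5 = arXiv:math/0111212, Lemma 2.1, §2–3
[GoldstonYildirim2001]; B. Green, T. Tao, Ann. of Math. 171 (2010), Lemma 1.3, App. D [GreenTao2010].
-/

noncomputable section

open scoped BigOperators Classical Topology
open Filter Finset Literature.NumberTheory.Sieve

namespace Summit.Parity.GeneralizedHardyLittlewood.Cruxes.RelativeDimOne.SingleMoebiusSplit

/-- **T1b-C — the truncated singular series of a `d = 1` system** (registered stub `stub_tssCompose`
of the line `single-moebius-split`). Given the general-data induction `TSSInduction t` for every `t`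
and the local data `TSSLocalData t` (Chinese remainder theorem) for every `t`, the truncated singular
series at staggered levels `R_i = N^{δ_i}` (`δ_i > 0`, `2∑_{j>i} δ_j ≤ δ_i`, `∑ δ_i ≤ 1/4`) satisfies
`|𝔖_R(Ψ) − 𝔖(Ψ)| ≤ ε (𝔖(Ψ) + 1)` for `N ≥ N₀(k, L, δ, ε)`, uniformly over non-degenerate systems of
`k + 1` forms with `‖Ψ‖_N ≤ L`: apply the induction to the root data of `Ψ` (full windows, frozen
primes `p ≤ 2t + L`, rough primes `p ∣ Π(Ψ)`), identify its two terms with `𝔖_R(Ψ)` and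
`∏_{p ≤ x} β_p(Ψ)`, and let `x → ∞`. -/
theorem stub_tssCompose : (∀ t : ℕ, TSSInduction t) → (∀ t : ℕ, TSSLocalData t) → ∀ k : ℕ, TruncSingularSeriesAsymp (k + 1) := by
  intro hA hB k L δ hδ hst hsum ε hε
  -- Step 0: the constants, all fixed before `N` and `Ψ`
  obtain ⟨c, hc, m, κ, hκ, hAC⟩ := hA (k + 1)
  have hκ0 : 0 ≤ κ := zero_le_one.trans hκ
  have hη0 : 0 < δ (Fin.last k) := hδ _
  have hlog2 : 0 < Real.log 2 := Real.log_pos (by norm_num)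
  -- `B = 2t² / (δ_k log 2)`
  obtain ⟨C, hC0, hmain⟩ := hAC (2 * ((k + 1 : ℕ) : ℝ) ^ 2 / (δ (Fin.last k) * Real.log 2))
    (div_nonneg (by positivity) (mul_pos hη0 hlog2).le)
  -- the frozen small primes `P = {p ≤ 2t + L}`
  set P : Finset ℕ := (Finset.range (2 * (k + 1) + L + 1)).filter Nat.Prime with hP
  have hPprime : ∀ p ∈ P, p.Prime := fun p hp => (Finset.mem_filter.mp hp).2
  have hPle : ∀ p ∈ P, p ≤ 2 * (k + 1) + L := fun p hp =>
    Nat.lt_succ_iff.mp (Finset.mem_range.mp (Finset.mem_filter.mp hp).1)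
  have hnotP : ∀ p : ℕ, p.Prime → p ∉ P → 2 * (k + 1) + L < p := fun p hp hpP => by
    by_contra h
    exact hpP (Finset.mem_filter.mpr ⟨Finset.mem_range.mpr (Nat.lt_succ_of_le (not_lt.mp h)), hp⟩)
  -- the constant `A = 2e⁵ (2t² + 10)` of the Landau bound and `K = C κ^{|P|} A^t`
  set A : ℝ := 2 * Real.exp 5 * (2 * ((k + 1 : ℕ) : ℝ) ^ 2 + 10) with hA'
  have hA0 : 0 ≤ A := by rw [hA']; positivity
  have hK0 : 0 ≤ C * κ ^ P.card * A ^ (k + 1) :=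
    mul_nonneg (mul_nonneg hC0 (pow_nonneg hκ0 _)) (pow_nonneg hA0 _)
  -- Step 2: the levels (this fixes `N₀`)
  obtain ⟨N₀, hN₀⟩ := tssC_levels k δ hδ hst hsum (2 * (L + 1) ^ 2) m ((∏ p ∈ P, (p : ℝ)) ^ 3)
    (C * κ ^ P.card * A ^ (k + 1)) c ε hc hε hK0
  refine ⟨N₀, fun N hN Ψ hΨ hL => ?_⟩
  obtain ⟨hLN, hN3, h8, hlev, hfloor, hstag, hgrowth⟩ := hN₀ N hN
  have hN0 : (0 : ℝ) < N := by exact_mod_cast lt_of_lt_of_le (by norm_num) hN3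
  have hℓ : 0 ≤ Real.log (N : ℝ) := Real.log_natCast_nonneg N
  -- Step 1: the data of `Ψ`
  obtain ⟨Q, hQprime, hQcard, hΘ, hrough, hgeneric⟩ := tssC_data (k + 1) L N Ψ hΨ hN3 hLN hL
  -- Steps 3–4: the estimate for every cut-off `x + 1 > N + 2t + L`
  have key : ∀ x : ℕ, N + (2 * (k + 1) + L) ≤ x →
      |truncSingularSeries Ψ (fun i => (N : ℝ) ^ δ i) - singularProductPartial Ψ x| ≤ ε := by
    intro x hx
    have hfl : ∀ i, ⌊(N : ℝ) ^ δ i⌋₊ < x + 1 := fun i => by have := hfloor i; omega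
    rw [← tssC_identify (k + 1) (hB (k + 1)) Ψ (fun i => (N : ℝ) ^ δ i) x hfl]
    refine (hmain (fun p => Finset.range p) (rootSet Ψ) P Q (fun i => (N : ℝ) ^ δ i)
      ((N : ℝ) ^ δ (Fin.last k)) N (x + 1) hPprime hQprime (fun p _ => Finset.Subset.refl _)
      (fun p hp hpP => ⟨rfl, ?_, fun i => hrough p hp ?_ i⟩)
      (fun p hp _ hpQ => hgeneric p hp hpQ) h8 hlev hfl (fun p hp => ?_) hstag ?_).trans ?_
    · have := hnotP p hp hpP
      omega
    · have := hnotP p hp hpP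
      omega
    · have := hPle p hp
      omega
    · -- `|Q| ≤ B log Rmin`
      rw [Real.log_rpow hN0]
      refine le_of_mul_le_mul_right ?_ hlog2
      have e : 2 * ((k + 1 : ℕ) : ℝ) ^ 2 / (δ (Fin.last k) * Real.log 2) *
          (δ (Fin.last k) * Real.log N) * Real.log 2 = 2 * ((k + 1 : ℕ) : ℝ) ^ 2 * Real.log N := by
        field_simp
      rw [e]
      exact hQcard
    · -- the error of the induction is `≤ K (log N)^{m+t} e^{−c√(log Rmin)} ≤ ε`
      have hF : ∏ p ∈ P, (((Finset.range p).card : ℝ) / p) = 1 :=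
        Finset.prod_eq_one fun p hp => by
          rw [Finset.card_range, div_self (by exact_mod_cast (hPprime p hp).ne_zero)]
      have hΘ' : ∏ p ∈ Q, ((p : ℝ) / ((p : ℝ) - 1)) ^ (k + 1) ≤ (A * Real.log N) ^ (k + 1) := by
        refine hΘ.trans_eq ?_
        rw [hA']
        ring
      have hX0 : 0 ≤ Real.exp (-(c * Real.sqrt (Real.log ((N : ℝ) ^ δ (Fin.last k))))) :=
        (Real.exp_pos _).le
      calc C * κ ^ P.card * (∏ p ∈ Q, ((p : ℝ) / ((p : ℝ) - 1)) ^ (k + 1)) *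
            (∏ p ∈ P, (((Finset.range p).card : ℝ) / p)) * Real.log (N : ℝ) ^ m *
              Real.exp (-(c * Real.sqrt (Real.log ((N : ℝ) ^ δ (Fin.last k)))))
          = C * κ ^ P.card * (∏ p ∈ Q, ((p : ℝ) / ((p : ℝ) - 1)) ^ (k + 1)) *
              Real.log (N : ℝ) ^ m *
                Real.exp (-(c * Real.sqrt (Real.log ((N : ℝ) ^ δ (Fin.last k))))) := by
            rw [hF, mul_one]
        _ ≤ C * κ ^ P.card * (A * Real.log N) ^ (k + 1) * Real.log (N : ℝ) ^ m *
              Real.exp (-(c * Real.sqrt (Real.log ((N : ℝ) ^ δ (Fin.last k))))) :=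
            mul_le_mul_of_nonneg_right (mul_le_mul_of_nonneg_right
              (mul_le_mul_of_nonneg_left hΘ' (mul_nonneg hC0 (pow_nonneg hκ0 _)))
              (pow_nonneg hℓ m)) hX0
        _ = C * κ ^ P.card * A ^ (k + 1) * Real.log N ^ (m + (k + 1)) *
              Real.exp (-(c * Real.sqrt (Real.log ((N : ℝ) ^ δ (Fin.last k))))) := by
            rw [mul_pow, pow_add]
            ring
        _ ≤ ε := hgrowth
  -- Step 5: the limit `x → ∞`
  have hT : Tendsto (fun x => |truncSingularSeries Ψ (fun i => (N : ℝ) ^ δ i) -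
      singularProductPartial Ψ x|) atTop
        (𝓝 |truncSingularSeries Ψ (fun i => (N : ℝ) ^ δ i) - singularProduct Ψ|) :=
    (tendsto_const_nhds.sub (tendsto_singularProductPartial_holds 1 (k + 1) Ψ hΨ)).abs
  have hle : |truncSingularSeries Ψ (fun i => (N : ℝ) ^ δ i) - singularProduct Ψ| ≤ ε :=
    le_of_tendsto hT (Filter.eventually_atTop.mpr ⟨N + (2 * (k + 1) + L), key⟩)
  have hS := singularProduct_nonneg' hΨ
  calc |truncSingularSeries Ψ (fun i => (N : ℝ) ^ δ i) - singularProduct Ψ| ≤ ε := hle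
    _ = ε * 1 := (mul_one ε).symm
    _ ≤ ε * (singularProduct Ψ + 1) := mul_le_mul_of_nonneg_left (by linarith) hε.le

end Summit.Parity.GeneralizedHardyLittlewood.Cruxes.RelativeDimOne.SingleMoebiusSplit
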